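import Summits.AnomalousDissipation.AnomalousDissipation.Theorems.ScalarAnomalySteadySourceFormal.Negative.CellLimit
import Summits.AnomalousDissipation.AnomalousDissipation.Theorems.ScalarAnomalySteadySourceFormal.Negative.ShearTotal
import Mathlib.Analysis.PSeries

/-!
# Negative knowledge for the crux `ScalarAnomalySteadySourceFormal` (stmt-AnomalousDissipation-0448), VIII-c:
# total dissipation under general band-limited stirring

Certified copy of §10.3 of the cdisprove work file.  The outer truncation of the square-band
inequality (`Negative.CellLimit.cell_band_modes_le`) carries the weight `K' + R`; it is removed by
the tail pigeonhole (`exists_slayer_small_tail`) and the vanishing of the time-integrated spectral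
tail `∫ sqTail θ L → 0` (`tendsto_integral_sqTail`, dominated convergence + Parseval), whence
(`cell_compl_finset_dissipation_le`, `cell_perT_dissipation_le`) for every `T > 0`, `K ≥ 0`:
`2ν ∫⁻_{(0,T)} ‖∇θ‖² ≤ ofReal (‖θ₀‖² + 16π²νK² ∫‖θ‖² + 8π #S M (K+R) ∫ slayerSum_K + 2 η_out(K,K) ∫‖θ‖)`.

Supports stmt-AnomalousDissipation-0448 (the band-limited no-go, files `Cell*`).
-/

set_option linter.dupNamespace false

noncomputable section

open scoped BigOperators Topology ENNReal NNReal InnerProductSpace ContDiff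
open Filter Set Function MeasureTheory UnitAddTorus Complex

namespace Summit.AnomalousDissipation.AnomalousDissipation.Theorems.ScalarAnomalySteadySourceFormal.Negative

open Literature.Analysis
open Literature.Analysis.FunctionSpaces Literature.Analysis.FunctionSpaces.Torus
open Literature.Analysis.FluidPDE Literature.Analysis.FluidPDE.Torus

/-- The frequency lattice `ℤ²` (local notation). -/
local notation "ℤ²" => Fin 2 → ℤ

section Tail

variable {ν : ℝ} {u : ℝ → UnitAddTorus (Fin 2) → EuclideanSpace ℝ (Fin 2)} {h θ₀ : UnitAddTorus (Fin 2) → ℝ}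
  {θ : ℝ → UnitAddTorus (Fin 2) → ℝ}

/-- The square boxes `sbox n`, `n ∈ ℕ`, exhaust the lattice. [folklore] -/
theorem tendsto_sbox_atTop : Tendsto (fun n : ℕ => box (n : ℤ) (n : ℤ)) atTop atTop := by
  refine tendsto_atTop_finset_of_monotone (fun a b hab p hp => ?_) fun p => ?_
  · rw [mem_box] at hp ⊢
    exact ⟨hp.1.trans (by exact_mod_cast hab), hp.2.trans (by exact_mod_cast hab)⟩
  · refine ⟨(|p 0|).toNat + (|p 1|).toNat, ?_⟩
    rw [mem_box]
    constructor <;> omega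

/-- **The time-integrated spectral tail vanishes**: `∫_{(0,T)} sqTail θ n → 0` as `n → ∞`
(Parseval for a.e. slice + dominated convergence). [folklore] -/
theorem tendsto_integral_sqTail (hw : IsWeakScalarTransportForced ν u (fun _ => h) θ₀ θ) {T : ℝ} (hT : 0 < T) :
    Tendsto (fun n : ℕ => ∫ t in Ioo 0 T, sqTail θ (n : ℤ) t) atTop (nhds 0) := by
  classical
  have hwT := hw T hT
  have hFm : ∀ n : ℕ, AEStronglyMeasurable (fun t => ∑ p ∈ box (n : ℤ) n, ‖modes θ t p‖ ^ 2) (volume.restrict (Ioo 0 T)) :=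
    fun n => (integrable_finsetSum _ fun p _ => forced_integrableOn_sq_modes hwT p).aestronglyMeasurable
  have hbound : ∀ n : ℕ, ∀ᵐ t ∂(volume.restrict (Ioo 0 T)), ‖∑ p ∈ box (n : ℤ) n, ‖modes θ t p‖ ^ 2‖ ≤ scalarL2Sq (θ t) := by
    intro n
    filter_upwards [forced_ae_sum_sq_modes_le hwT (box (n : ℤ) n)] with t ht
    rw [Real.norm_eq_abs, abs_of_nonneg (Finset.sum_nonneg fun _ _ => sq_nonneg _)]
    exact ht
  have hlim : ∀ᵐ t ∂(volume.restrict (Ioo 0 T)),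
      Tendsto (fun n : ℕ => ∑ p ∈ box (n : ℤ) n, ‖modes θ t p‖ ^ 2) atTop (nhds (scalarL2Sq (θ t))) := by
    filter_upwards [forced_ae_memLp_two hwT] with t ht
    exact (FunctionSpaces.Torus.hasSum_sq_norm_mFourierCoeff_ofReal ht).comp tendsto_sbox_atTop
  have hDCT := tendsto_integral_of_dominated_convergence (fun t => scalarL2Sq (θ t)) hFm
    (forced_integrableOn_scalarL2Sq hwT) hbound hlim
  have e : ∀ n : ℕ, ∫ t in Ioo 0 T, sqTail θ (n : ℤ) t =
      (∫ t in Ioo 0 T, scalarL2Sq (θ t)) - ∫ t in Ioo 0 T, ∑ p ∈ box (n : ℤ) n, ‖modes θ t p‖ ^ 2 := by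
    intro n
    rw [← integral_sub (forced_integrableOn_scalarL2Sq hwT) (integrable_finsetSum _ fun p _ => forced_integrableOn_sq_modes hwT p)]
    simp only [sqTail]
  simp_rw [e]
  have := (tendsto_const_nhds (x := ∫ t in Ioo 0 T, scalarL2Sq (θ t))).sub hDCT
  rwa [sub_self] at this

end Tail

section CellTotal

variable {ν : ℝ} {S : Finset ℤ²} {R : ℕ} {M : ℝ} {c : ℝ → ℤ² → EuclideanSpace ℂ (Fin 2)}
  {u : ℝ → UnitAddTorus (Fin 2) → EuclideanSpace ℝ (Fin 2)} {h θ₀ : UnitAddTorus (Fin 2) → ℝ}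
  {θ : ℝ → UnitAddTorus (Fin 2) → ℝ}

/-- **Finite sums of complement modes** (square boxes, general band-limited stirring): for every finite
`F` outside `sbox K`, `2ν ∑_{p∈F} 4π²|p|² q_p ≤ ‖θ₀‖² + 8π #S M (K+R) ∫ slayerSum_K + 2 η_out ∫‖θ‖`. [folklore] -/
theorem cell_compl_finset_dissipation_le (hw : IsWeakScalarTransportForced ν u (fun _ => h) θ₀ θ) (hν : 0 ≤ ν)
    (hu : ∀ s, u s = realTrigPoly S (c s)) (hh : MemLp h 2 volume) (hθ₀ : MemLp θ₀ 2 volume)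
    (hc : ∀ k, Continuous fun s => c s k) (hM : ∀ s k, ‖c s k‖ ≤ M) (hM0 : 0 ≤ M)
    (htrans : ∀ s, ∀ k ∈ S, zdot k (c s k) = 0) (hS : ∀ k ∈ S, |k 0| ≤ R ∧ |k 1| ≤ R)
    {K : ℤ} (hK : 0 ≤ K) {T : ℝ} (hT : 0 < T) {F : Finset ℤ²} (hF : ∀ p ∈ F, p ∉ box K K) :
    2 * ν * ∑ p ∈ F, 4 * Real.pi ^ 2 * freqNormSq p * modeEnergyInt θ T p ≤
      scalarL2Sq θ₀ + 8 * Real.pi * S.card * M * (K + R) * (∫ t in Ioo 0 T, slayerSum (K - R) (K + R) (modes θ t)) +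
        2 * sourceTailMass K K h * ∫ t in Ioo 0 T, Real.sqrt (scalarL2Sq (θ t)) := by
  classical
  have hhi : Integrable h volume := hh.integrable one_le_two
  set G : ℝ := ∫ t in Ioo 0 T, slayerSum (K - R) (K + R) (modes θ t) with hG
  set W : ℝ := ∫ t in Ioo 0 T, Real.sqrt (scalarL2Sq (θ t)) with hW
  set C₀ : ℝ := scalarL2Sq θ₀ + 8 * Real.pi * S.card * M * (K + R) * G + 2 * sourceTailMass K K h * W with hC₀
  have hW0 : 0 ≤ W := setIntegral_nonneg measurableSet_Ioo fun _ _ => Real.sqrt_nonneg _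
  have hG0 : 0 ≤ G := setIntegral_nonneg measurableSet_Ioo fun _ _ => slayerSum_nonneg _ _ _
  have hR0 : (0 : ℝ) ≤ R := by exact_mod_cast R.zero_le
  have hπ := Real.pi_pos
  -- a square box containing F
  obtain ⟨L, hL⟩ : ∃ L : ℕ, ∀ p ∈ F, |p 0| ≤ L ∧ |p 1| ≤ L := by
    refine ⟨F.sup fun p => (|p 0|).toNat + (|p 1|).toNat, fun p hp => ?_⟩
    have h1 : (|p 0|).toNat + (|p 1|).toNat ≤ F.sup fun p => (|p 0|).toNat + (|p 1|).toNat :=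
      Finset.le_sup (f := fun p : ℤ² => (|p 0|).toNat + (|p 1|).toNat) hp
    constructor <;> omega
  -- main estimate for every `N ≥ max (L, K, R, 1)`: with the tail pigeonhole over `K' ∈ [N, 2N)`
  have key : ∀ N : ℕ, 1 ≤ N → R ≤ N → (L : ℤ) ≤ N → K ≤ N →
      2 * ν * ∑ p ∈ F, 4 * Real.pi ^ 2 * freqNormSq p * modeEnergyInt θ T p ≤
        C₀ + 8 * Real.pi * S.card * M * (6 * R * ∫ t in Ioo 0 T, sqTail θ ((N : ℤ) - R) t) := by
    intro N hN1 hNR hNL hNK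
    obtain ⟨K', hK'I, hK'⟩ := exists_slayer_small_tail (R := R) hw hT (N : ℤ) hN1
    rw [Finset.mem_Ico] at hK'I
    have hK'0 : (0 : ℤ) ≤ K' := le_trans (Int.natCast_nonneg N) hK'I.1
    have hband := cell_band_modes_le hw hu hhi hθ₀ hc hM hM0 htrans hS hK hK'0 hT
    rw [integral_bandDiss_eq hw hT] at hband
    have hFsub : F ⊆ box K' K' \ box K K := by
      intro p hp
      rw [Finset.mem_sdiff, mem_box]
      refine ⟨⟨?_, ?_⟩, hF p hp⟩
      · have := (hL p hp).1; omega
      · have := (hL p hp).2; omega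
    have hmono : ∑ p ∈ F, 4 * Real.pi ^ 2 * freqNormSq p * modeEnergyInt θ T p ≤
        ∑ p ∈ box K' K' \ box K K, 4 * Real.pi ^ 2 * freqNormSq p * ∫ t in Ioo 0 T, ‖modes θ t p‖ ^ 2 :=
      Finset.sum_le_sum_of_subset_of_nonneg hFsub fun p _ _ => by
        have := freqNormSq_nonneg p; have := modeEnergyInt_nonneg θ T p
        unfold modeEnergyInt at this; positivity
    have hsm := sourceMass_le_sourceTailMass hh (𝔅 := box K' K' \ box K K) fun p hp => (Finset.mem_sdiff.1 hp).2
    -- the outer layer term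
    have hout : (K' + R) * ∫ t in Ioo 0 T, slayerSum (K' - R) (K' + R) (modes θ t) ≤
        6 * R * ∫ t in Ioo 0 T, sqTail θ ((N : ℤ) - R) t := by
      have hNpos : (0 : ℝ) < N := by exact_mod_cast hN1
      have hK'le : (K' : ℝ) + R ≤ 3 * N := by
        have h1 : (K' : ℝ) < (N : ℝ) + N := by exact_mod_cast hK'I.2
        have h2 : (R : ℝ) ≤ N := by exact_mod_cast hNR
        linarith
      have hK'0r : (0 : ℝ) ≤ K' := by exact_mod_cast hK'0
      have hK'R0 : (0 : ℝ) ≤ K' + R := by linarith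
      calc (K' + R) * ∫ t in Ioo 0 T, slayerSum (K' - R) (K' + R) (modes θ t)
          ≤ (3 * N) * (2 * R * (∫ t in Ioo 0 T, sqTail θ ((N : ℤ) - R) t) / N) :=
            mul_le_mul hK'le hK' (setIntegral_nonneg measurableSet_Ioo fun _ _ => slayerSum_nonneg _ _ _) (by positivity)
        _ = 6 * R * ∫ t in Ioo 0 T, sqTail θ ((N : ℤ) - R) t := by field_simp; ring
    calc 2 * ν * ∑ p ∈ F, 4 * Real.pi ^ 2 * freqNormSq p * modeEnergyInt θ T p
        ≤ 2 * ν * ∑ p ∈ box K' K' \ box K K, 4 * Real.pi ^ 2 * freqNormSq p * ∫ t in Ioo 0 T, ‖modes θ t p‖ ^ 2 := by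
          gcongr
      _ ≤ scalarL2Sq θ₀ + 8 * Real.pi * S.card * M * ((K + R) * G +
            (K' + R) * ∫ t in Ioo 0 T, slayerSum (K' - R) (K' + R) (modes θ t)) +
          2 * sourceMass (box K' K' \ box K K) h * W := hband
      _ ≤ scalarL2Sq θ₀ + 8 * Real.pi * S.card * M * ((K + R) * G + 6 * R * ∫ t in Ioo 0 T, sqTail θ ((N : ℤ) - R) t) +
          2 * sourceTailMass K K h * W := by gcongr
      _ = C₀ + 8 * Real.pi * S.card * M * (6 * R * ∫ t in Ioo 0 T, sqTail θ ((N : ℤ) - R) t) := by rw [hC₀]; ring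
  -- let `N → ∞` through the tail
  refine le_of_forall_pos_le_add fun ε hε => ?_
  set A : ℝ := 8 * Real.pi * S.card * M * (6 * R) with hA
  have hA0 : 0 ≤ A := by positivity
  have hA1 : 0 < A + 1 := by positivity
  have hev := (tendsto_order.1 (tendsto_integral_sqTail hw hT)).2 (ε / (A + 1)) (by positivity)
  obtain ⟨n₀, hn₀⟩ := eventually_atTop.1 hev
  set n : ℕ := max n₀ (max (max L 1) K.toNat) with hn
  have hsmall : ∫ t in Ioo 0 T, sqTail θ (n : ℤ) t < ε / (A + 1) := hn₀ n (le_max_left _ _)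
  set N : ℕ := n + R with hN
  have hN1 : 1 ≤ N := by omega
  have hNR : R ≤ N := by omega
  have hNL : (L : ℤ) ≤ N := by
    have : L ≤ N := by omega
    exact_mod_cast this
  have hNK : K ≤ N := by
    have h1 : K.toNat ≤ N := by omega
    have h2 : K ≤ (K.toNat : ℤ) := Int.self_le_toNat K
    omega
  have hkey := key N hN1 hNR hNL hNK
  have hNn : ((N : ℤ) - R) = (n : ℤ) := by rw [hN]; push_cast; ring
  rw [hNn] at hkey
  calc _ ≤ C₀ + 8 * Real.pi * S.card * M * (6 * R * ∫ t in Ioo 0 T, sqTail θ (n : ℤ) t) := hkey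
    _ = C₀ + A * ∫ t in Ioo 0 T, sqTail θ (n : ℤ) t := by rw [hA]; ring
    _ ≤ C₀ + A * (ε / (A + 1)) := by gcongr
    _ ≤ C₀ + ε := by
        have : A * (ε / (A + 1)) ≤ ε := by
          rw [mul_div_assoc', div_le_iff₀ hA1]
          nlinarith
        linarith

/-- **Every finite set of modes** (square boxes, general band-limited stirring). [folklore] -/
theorem cell_finset_dissipation_le (hw : IsWeakScalarTransportForced ν u (fun _ => h) θ₀ θ) (hν : 0 ≤ ν)
    (hu : ∀ s, u s = realTrigPoly S (c s)) (hh : MemLp h 2 volume) (hθ₀ : MemLp θ₀ 2 volume)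
    (hc : ∀ k, Continuous fun s => c s k) (hM : ∀ s k, ‖c s k‖ ≤ M) (hM0 : 0 ≤ M)
    (htrans : ∀ s, ∀ k ∈ S, zdot k (c s k) = 0) (hS : ∀ k ∈ S, |k 0| ≤ R ∧ |k 1| ≤ R)
    {K : ℤ} (hK : 0 ≤ K) {T : ℝ} (hT : 0 < T) (F : Finset ℤ²) :
    2 * ν * ∑ p ∈ F, 4 * Real.pi ^ 2 * freqNormSq p * modeEnergyInt θ T p ≤
      scalarL2Sq θ₀ + 16 * Real.pi ^ 2 * ν * K ^ 2 * (∫ t in Ioo 0 T, scalarL2Sq (θ t)) +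
        8 * Real.pi * S.card * M * (K + R) * (∫ t in Ioo 0 T, slayerSum (K - R) (K + R) (modes θ t)) +
        2 * sourceTailMass K K h * ∫ t in Ioo 0 T, Real.sqrt (scalarL2Sq (θ t)) := by
  classical
  have hsplit : ∑ p ∈ F, 4 * Real.pi ^ 2 * freqNormSq p * modeEnergyInt θ T p =
      ∑ p ∈ F.filter (fun p => p ∈ box K K), 4 * Real.pi ^ 2 * freqNormSq p * modeEnergyInt θ T p +
      ∑ p ∈ F.filter (fun p => p ∉ box K K), 4 * Real.pi ^ 2 * freqNormSq p * modeEnergyInt θ T p :=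
    (Finset.sum_filter_add_sum_filter_not F (fun p => p ∈ box K K) _).symm
  have hin : ∑ p ∈ F.filter (fun p => p ∈ box K K), 4 * Real.pi ^ 2 * freqNormSq p * modeEnergyInt θ T p ≤
      4 * Real.pi ^ 2 * (K ^ 2 + K ^ 2) * ∫ t in Ioo 0 T, scalarL2Sq (θ t) := by
    refine le_trans ?_ (box_dissipation_le hw hT)
    refine Finset.sum_le_sum_of_subset_of_nonneg (fun p hp => (Finset.mem_filter.1 hp).2) fun p _ _ => ?_
    have := freqNormSq_nonneg p; have := modeEnergyInt_nonneg θ T p; positivity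
  have hout := cell_compl_finset_dissipation_le hw hν hu hh hθ₀ hc hM hM0 htrans hS hK hT
    (F := F.filter (fun p => p ∉ box K K)) fun p hp => (Finset.mem_filter.1 hp).2
  rw [hsplit, mul_add]
  nlinarith [hin, hout, hν]

/-- **Per-`T` dissipation inequality** under general band-limited stirring:
`2ν ∫⁻_{(0,T)} ‖∇θ‖² ≤ ofReal (‖θ₀‖² + 16π²νK² ∫‖θ‖² + 8π #S M (K+R) ∫ slayerSum_K + 2 η_out(K,K) ∫‖θ‖)`. [folklore] -/
theorem cell_perT_dissipation_le (hw : IsWeakScalarTransportForced ν u (fun _ => h) θ₀ θ) (hν : 0 ≤ ν)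
    (hu : ∀ s, u s = realTrigPoly S (c s)) (hh : MemLp h 2 volume) (hθ₀ : MemLp θ₀ 2 volume)
    (hc : ∀ k, Continuous fun s => c s k) (hM : ∀ s k, ‖c s k‖ ≤ M) (hM0 : 0 ≤ M)
    (htrans : ∀ s, ∀ k ∈ S, zdot k (c s k) = 0) (hS : ∀ k ∈ S, |k 0| ≤ R ∧ |k 1| ≤ R)
    {K : ℤ} (hK : 0 ≤ K) {T : ℝ} (hT : 0 < T) :
    ENNReal.ofReal (2 * ν) * ∫⁻ t in Ioo 0 T, eScalarGradNormSq (θ t) ≤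
      ENNReal.ofReal (scalarL2Sq θ₀ + 16 * Real.pi ^ 2 * ν * K ^ 2 * (∫ t in Ioo 0 T, scalarL2Sq (θ t)) +
        8 * Real.pi * S.card * M * (K + R) * (∫ t in Ioo 0 T, slayerSum (K - R) (K + R) (modes θ t)) +
        2 * sourceTailMass K K h * ∫ t in Ioo 0 T, Real.sqrt (scalarL2Sq (θ t))) := by
  rw [lintegral_grad_eq_iSup hw hT, ENNReal.mul_iSup]
  refine iSup_le fun F => ?_
  rw [← ENNReal.ofReal_mul (by positivity)]
  exact ENNReal.ofReal_le_ofReal (cell_finset_dissipation_le hw hν hu hh hθ₀ hc hM hM0 htrans hS hK hT F)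

end CellTotal

end Summit.AnomalousDissipation.AnomalousDissipation.Theorems.ScalarAnomalySteadySourceFormal.Negative
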